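import Summits.Ventures.DiscreteObjects.PP12.PrimeOrderStructure
import Summits.Ventures.DiscreteObjects.PP12.FlagTenIndexSets

/-!
# PP(12), order-13 cell: powers of `σ`, the fixed antiflag and the base frame (kernel; part 1 of the plane ⇒ lift-array reduction)
Framing: lottery ticket; floor = certified bounds/negative ranges.

Cell pub-namedobj (venture DiscreteObjects), target (M), designs gen 16. `OrderThirteenCollineation` TYPES the lift normal form
`LiftData 11 13` / `LiftData.Valid` of a projective plane of order 12 with a collineation `σ` of order 13 and the census statement
`NoLiftData13` (decided EMPTY outside the kernel: designs E1 `liftplus.c` = `liftplus.py`, farm twin j098200; in print Janko–van Trung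
1981/82); `PrimeOrderStructure` proves that the fixed structure of such a `σ` is an ANTIFLAG `(P₀, l₀)`. The step "plane ⇒ valid lift
data" (FAMILY-B1P-PLUS §1–§2) was so far a paper proof; this file and `OrderThirteenReduction` make it a kernel theorem. Here:

* `Collineation.power k` — the `k`-th power of a collineation as a collineation; for `σ ≠ 1`, `σ¹³ = 1`, `13 ∤ k` the power `σ^k`
  fixes exactly `P₀ = fpt13` and exactly `l₀ = fln13` (`eq_fpt13_of_pow_fixed`, `eq_fln13_of_pow_fixed`);
* base frame: a point `Q ∈ l₀` (`bpt13`), the line `N = P₀Q` (`bln13`); the pencil of `P₀` is a regular `⟨σ⟩`-orbit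
  (`pow_bln13_injective`); bijections `Fin 11 ≃` (points of `N` other than `P₀, Q`) (`pt13`, via `card_pt13_subtype`) and
  `Fin 11 ≃` (lines through `Q` other than `l₀, N`) (`ln13`), with their incidence facts (`L_s ∩ N = L_s ∩ l₀ = L_s ∩ L_{s'} = {Q}`,
  `P₀, P_t ∉ L_s`, `σ^k P_t ∉ l₀`, …).

General position facts only (Mathlib `Configuration.ProjectivePlane`); nothing asserts any census statement. No `sorry`, no new axioms.
-/

namespace Summit.Ventures.DiscreteObjects.PP12

open Configuration Finset
open scoped Classical

namespace Collineation

variable {P L : Type*} [Membership P L] (σ : Collineation P L)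

/-- The `k`-th power of a collineation, as a collineation. -/
def power (k : ℕ) : Collineation P L where
  onPoints := σ.onPoints ^ k
  onLines := σ.onLines ^ k
  mem_iff := σ.pow_mem_iff k

/-- points: `(σ.power k) = σ^k` -/
@[simp] theorem power_onPoints (k : ℕ) : (σ.power k).onPoints = σ.onPoints ^ k := rfl

/-- lines: `(σ.power k) = σ^k` -/
@[simp] theorem power_onLines (k : ℕ) : (σ.power k).onLines = σ.onLines ^ k := rfl

/-- `σ^k p ∈ m ↔ p ∈ σ^{-k} m`, in the form `σ^k p ∈ m ↔ p ∈ (σL^k)⁻¹ m`. -/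
theorem pow_apply_mem_iff (k : ℕ) (p : P) (m : L) : (σ.onPoints ^ k) p ∈ m ↔ p ∈ (σ.onLines ^ k).symm m := by
  conv_lhs => rw [← (σ.onLines ^ k).apply_symm_apply m]
  exact σ.pow_mem_iff k p _

/-- `p ∈ σL^k m ↔ (σP^k)⁻¹ p ∈ m`. -/
theorem mem_pow_apply_iff (k : ℕ) (p : P) (m : L) : p ∈ (σ.onLines ^ k) m ↔ (σ.onPoints ^ k).symm p ∈ m := by
  conv_lhs => rw [← (σ.onPoints ^ k).apply_symm_apply p]
  exact σ.pow_mem_iff k _ m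

variable [ProjectivePlane P L] [Fintype P] [Fintype L]

section Thirteen

variable (h12 : ProjectivePlane.order P L = 12) (hne : σ.onPoints ≠ 1) (hq : σ.onPoints ^ 13 = 1)

/-! ### Powers of `σ` -/

omit [ProjectivePlane P L] [Fintype P] [Fintype L] in
include hq in
/-- `(σ^k)¹³ = 1`. -/
theorem power_pow_thirteen (k : ℕ) : (σ.power k).onPoints ^ 13 = 1 := by
  rw [power_onPoints, ← pow_mul, mul_comm, pow_mul, hq, one_pow]

omit [ProjectivePlane P L] [Fintype P] [Fintype L] in
include hne hq in
/-- `σ^k ≠ 1` unless `13 ∣ k`. -/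
theorem pow_ne_one_of_not_dvd {k : ℕ} (hk : ¬ 13 ∣ k) : σ.onPoints ^ k ≠ 1 := by
  haveI : Fact (Nat.Prime 13) := ⟨by norm_num⟩
  have hord : orderOf σ.onPoints = 13 := orderOf_eq_prime hq hne
  intro h
  exact hk (hord ▸ orderOf_dvd_of_pow_eq_one h)

/-! ### The fixed antiflag `(P₀, l₀)` -/

/-- **`P₀`**: the fixed point of `σ`. -/
noncomputable def fpt13 : P := Classical.choose (σ.existsUnique_fixed_point_q13 h12 hne hq).exists

/-- **`l₀`**: the fixed line of `σ`. -/
noncomputable def fln13 : L := Classical.choose (σ.existsUnique_fixed_line_q13 h12 hne hq).exists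

/-- `P₀` is fixed. -/
theorem fpt13_fixed : σ.onPoints (σ.fpt13 h12 hne hq) = σ.fpt13 h12 hne hq :=
  Classical.choose_spec (σ.existsUnique_fixed_point_q13 h12 hne hq).exists

/-- `l₀` is fixed. -/
theorem fln13_fixed : σ.onLines (σ.fln13 h12 hne hq) = σ.fln13 h12 hne hq :=
  Classical.choose_spec (σ.existsUnique_fixed_line_q13 h12 hne hq).exists

/-- `P₀` is the only fixed point. -/
theorem eq_fpt13_of_fixed {p : P} (hp : σ.onPoints p = p) : p = σ.fpt13 h12 hne hq :=
  (σ.existsUnique_fixed_point_q13 h12 hne hq).unique hp (σ.fpt13_fixed h12 hne hq)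

/-- `l₀` is the only fixed line. -/
theorem eq_fln13_of_fixed {m : L} (hm : σ.onLines m = m) : m = σ.fln13 h12 hne hq :=
  (σ.existsUnique_fixed_line_q13 h12 hne hq).unique hm (σ.fln13_fixed h12 hne hq)

/-- `P₀ ∉ l₀` (antiflag). -/
theorem fpt13_not_mem_fln13 : σ.fpt13 h12 hne hq ∉ σ.fln13 h12 hne hq :=
  σ.fixed_point_not_mem_fixed_line_q13 h12 hne hq (σ.fpt13_fixed h12 hne hq) (σ.fln13_fixed h12 hne hq)

/-- Powers fix `P₀`. -/
theorem pow_fpt13 (k : ℕ) : (σ.onPoints ^ k) (σ.fpt13 h12 hne hq) = σ.fpt13 h12 hne hq :=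
  Equiv.Perm.pow_apply_eq_self_of_apply_eq_self (σ.fpt13_fixed h12 hne hq) k

/-- Powers fix `l₀`. -/
theorem pow_fln13 (k : ℕ) : (σ.onLines ^ k) (σ.fln13 h12 hne hq) = σ.fln13 h12 hne hq :=
  Equiv.Perm.pow_apply_eq_self_of_apply_eq_self (σ.fln13_fixed h12 hne hq) k

/-- A point fixed by `σ^k`, `13 ∤ k`, is `P₀`. -/
theorem eq_fpt13_of_pow_fixed {k : ℕ} (hk : ¬ 13 ∣ k) {p : P} (hp : (σ.onPoints ^ k) p = p) : p = σ.fpt13 h12 hne hq := by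
  have hne' : (σ.power k).onPoints ≠ 1 := σ.pow_ne_one_of_not_dvd hne hq hk
  obtain ⟨p₁, -, huniq⟩ := (σ.power k).existsUnique_fixed_point_q13 h12 hne' (σ.power_pow_thirteen hq k)
  exact (huniq p hp).trans (huniq _ (σ.pow_fpt13 h12 hne hq k)).symm

/-- A line fixed by `σ^k`, `13 ∤ k`, is `l₀`. -/
theorem eq_fln13_of_pow_fixed {k : ℕ} (hk : ¬ 13 ∣ k) {m : L} (hm : (σ.onLines ^ k) m = m) : m = σ.fln13 h12 hne hq := by
  have hne' : (σ.power k).onPoints ≠ 1 := σ.pow_ne_one_of_not_dvd hne hq hk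
  obtain ⟨m₁, -, huniq⟩ := (σ.power k).existsUnique_fixed_line_q13 h12 hne' (σ.power_pow_thirteen hq k)
  exact (huniq m hm).trans (huniq _ (σ.pow_fln13 h12 hne hq k)).symm

/-- Powers map points off `l₀` to points off `l₀`. -/
theorem pow_not_mem_fln13 (k : ℕ) {p : P} (hp : p ∉ σ.fln13 h12 hne hq) : (σ.onPoints ^ k) p ∉ σ.fln13 h12 hne hq := by
  intro h
  rw [← σ.pow_fln13 h12 hne hq k, σ.pow_mem_iff] at h
  exact hp h

/-- Powers map points of `l₀` to points of `l₀`. -/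
theorem pow_mem_fln13 (k : ℕ) {p : P} (hp : p ∈ σ.fln13 h12 hne hq) : (σ.onPoints ^ k) p ∈ σ.fln13 h12 hne hq := by
  have h := (σ.pow_mem_iff k p (σ.fln13 h12 hne hq)).2 hp
  rwa [σ.pow_fln13 h12 hne hq k] at h

/-! ### Base choices: `Q ∈ l₀`, `N = P₀ Q` -/

/-- **`Q`**: a point of `l₀` (base point). -/
noncomputable def bpt13 : P := Classical.choose (exists_mem_ne (P := P) (σ.fln13 h12 hne hq) (σ.fpt13 h12 hne hq))

/-- `Q ∈ l₀`. -/
theorem bpt13_mem_fln13 : σ.bpt13 h12 hne hq ∈ σ.fln13 h12 hne hq :=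
  (Classical.choose_spec (exists_mem_ne (P := P) (σ.fln13 h12 hne hq) (σ.fpt13 h12 hne hq))).1

/-- `Q ≠ P₀`. -/
theorem bpt13_ne_fpt13 : σ.bpt13 h12 hne hq ≠ σ.fpt13 h12 hne hq :=
  (Classical.choose_spec (exists_mem_ne (P := P) (σ.fln13 h12 hne hq) (σ.fpt13 h12 hne hq))).2

/-- **`N`**: the line `P₀ Q` (base line of the pencil of `P₀`). -/
noncomputable def bln13 : L := HasLines.mkLine (σ.bpt13_ne_fpt13 h12 hne hq)

/-- `Q ∈ N`. -/
theorem bpt13_mem_bln13 : σ.bpt13 h12 hne hq ∈ σ.bln13 h12 hne hq := (HasLines.mkLine_ax (σ.bpt13_ne_fpt13 h12 hne hq)).1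

/-- `P₀ ∈ N`. -/
theorem fpt13_mem_bln13 : σ.fpt13 h12 hne hq ∈ σ.bln13 h12 hne hq := (HasLines.mkLine_ax (σ.bpt13_ne_fpt13 h12 hne hq)).2

/-- `N ≠ l₀`. -/
theorem bln13_ne_fln13 : σ.bln13 h12 hne hq ≠ σ.fln13 h12 hne hq := fun h =>
  σ.fpt13_not_mem_fln13 h12 hne hq (h ▸ σ.fpt13_mem_bln13 h12 hne hq)

/-- `N ∩ l₀ = {Q}`. -/
theorem eq_bpt13_of_mem_bln13_of_mem_fln13 {p : P} (h1 : p ∈ σ.bln13 h12 hne hq) (h2 : p ∈ σ.fln13 h12 hne hq) :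
    p = σ.bpt13 h12 hne hq :=
  (Nondegenerate.eq_or_eq h1 (σ.bpt13_mem_bln13 h12 hne hq) h2 (σ.bpt13_mem_fln13 h12 hne hq)).resolve_right
    (σ.bln13_ne_fln13 h12 hne hq)

/-- `σ^k Q = Q` only for `13 ∣ k`. -/
theorem pow_bpt13_ne {k : ℕ} (hk : ¬ 13 ∣ k) : (σ.onPoints ^ k) (σ.bpt13 h12 hne hq) ≠ σ.bpt13 h12 hne hq := fun h =>
  σ.bpt13_ne_fpt13 h12 hne hq (σ.eq_fpt13_of_pow_fixed h12 hne hq hk h)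

/-- **The pencil of `P₀` is a regular orbit**: `σL^x N = σL^y N` with `x, y < 13` forces `x = y`. -/
theorem pow_bln13_injective {x y : ℕ} (hx : x < 13) (hy : y < 13)
    (h : (σ.onLines ^ x) (σ.bln13 h12 hne hq) = (σ.onLines ^ y) (σ.bln13 h12 hne hq)) : x = y := by
  by_contra hxy
  -- reduce to `N = σL^d N` with `0 < d < 13`
  have key : ∀ a b : ℕ, a < b → b < 13 → (σ.onLines ^ a) (σ.bln13 h12 hne hq) = (σ.onLines ^ b) (σ.bln13 h12 hne hq) → False := by
    intro a b hab hb e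
    have e' : (σ.onLines ^ a) (σ.bln13 h12 hne hq) = (σ.onLines ^ a) ((σ.onLines ^ (b - a)) (σ.bln13 h12 hne hq)) := by
      rw [← Equiv.Perm.mul_apply, ← pow_add, show a + (b - a) = b by omega]; exact e
    have hfix := ((σ.onLines ^ a).injective e').symm
    have hN := σ.eq_fln13_of_pow_fixed h12 hne hq (k := b - a) (by omega) hfix
    exact σ.bln13_ne_fln13 h12 hne hq hN
  rcases Nat.lt_or_gt_of_ne hxy with hlt | hlt
  · exact key x y hlt hy h
  · exact key y x hlt hx h.symm

/-! ### The index sets: points of `N` other than `P₀, Q`; lines through `Q` other than `l₀, N` -/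

/-- `N ∖ {P₀, Q}` has `11` points. -/
theorem card_pt13_subtype :
    Fintype.card {p : P // p ∈ σ.bln13 h12 hne hq ∧ p ≠ σ.fpt13 h12 hne hq ∧ p ≠ σ.bpt13 h12 hne hq} = 11 := by
  rw [Fintype.card_subtype]
  have h13 := card_points_on_line (P := P) (σ.bln13 h12 hne hq)
  rw [h12] at h13
  have hset : (univ.filter fun p : P => p ∈ σ.bln13 h12 hne hq ∧ p ≠ σ.fpt13 h12 hne hq ∧ p ≠ σ.bpt13 h12 hne hq)
      = ((univ.filter fun p : P => p ∈ σ.bln13 h12 hne hq).erase (σ.fpt13 h12 hne hq)).erase (σ.bpt13 h12 hne hq) := by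
    ext p
    simp only [mem_filter, mem_univ, true_and, mem_erase]
    tauto
  have hm1 : σ.fpt13 h12 hne hq ∈ univ.filter fun p : P => p ∈ σ.bln13 h12 hne hq := by
    simp [σ.fpt13_mem_bln13 h12 hne hq]
  have hm2 : σ.bpt13 h12 hne hq ∈ (univ.filter fun p : P => p ∈ σ.bln13 h12 hne hq).erase (σ.fpt13 h12 hne hq) := by
    rw [mem_erase]
    exact ⟨σ.bpt13_ne_fpt13 h12 hne hq, by simp [σ.bpt13_mem_bln13 h12 hne hq]⟩
  rw [hset, card_erase_of_mem hm2, card_erase_of_mem hm1, h13]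

/-- The pencil of `Q` minus `{l₀, N}` has `11` lines. -/
theorem card_ln13_subtype :
    Fintype.card {m : L // σ.bpt13 h12 hne hq ∈ m ∧ m ≠ σ.fln13 h12 hne hq ∧ m ≠ σ.bln13 h12 hne hq} = 11 := by
  rw [Fintype.card_subtype]
  have h13 := card_lines_through (L := L) (σ.bpt13 h12 hne hq)
  rw [h12] at h13
  have hset : (univ.filter fun m : L => σ.bpt13 h12 hne hq ∈ m ∧ m ≠ σ.fln13 h12 hne hq ∧ m ≠ σ.bln13 h12 hne hq)
      = ((univ.filter fun m : L => σ.bpt13 h12 hne hq ∈ m).erase (σ.fln13 h12 hne hq)).erase (σ.bln13 h12 hne hq) := by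
    ext m
    simp only [mem_filter, mem_univ, true_and, mem_erase]
    tauto
  have hm1 : σ.fln13 h12 hne hq ∈ univ.filter fun m : L => σ.bpt13 h12 hne hq ∈ m := by
    simp [σ.bpt13_mem_fln13 h12 hne hq]
  have hm2 : σ.bln13 h12 hne hq ∈ (univ.filter fun m : L => σ.bpt13 h12 hne hq ∈ m).erase (σ.fln13 h12 hne hq) := by
    rw [mem_erase]
    exact ⟨σ.bln13_ne_fln13 h12 hne hq, by simp [σ.bpt13_mem_bln13 h12 hne hq]⟩
  rw [hset, card_erase_of_mem hm2, card_erase_of_mem hm1, h13]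

/-- `Fin 11 ≃` the points of `N` other than `P₀, Q`. -/
noncomputable def ept13 : Fin 11 ≃ {p : P // p ∈ σ.bln13 h12 hne hq ∧ p ≠ σ.fpt13 h12 hne hq ∧ p ≠ σ.bpt13 h12 hne hq} :=
  (Fintype.equivFinOfCardEq (σ.card_pt13_subtype h12 hne hq)).symm

/-- `Fin 11 ≃` the lines through `Q` other than `l₀, N`. -/
noncomputable def eln13 : Fin 11 ≃ {m : L // σ.bpt13 h12 hne hq ∈ m ∧ m ≠ σ.fln13 h12 hne hq ∧ m ≠ σ.bln13 h12 hne hq} :=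
  (Fintype.equivFinOfCardEq (σ.card_ln13_subtype h12 hne hq)).symm

/-- **`P_t`**: the base point of free point orbit `t` (its point on `N`). -/
noncomputable def pt13 (t : Fin 11) : P := (σ.ept13 h12 hne hq t).1

/-- **`L_s`**: the base line of free line orbit `s` (its line through `Q`). -/
noncomputable def ln13 (s : Fin 11) : L := (σ.eln13 h12 hne hq s).1

/-- `P_t ∈ N`. -/
theorem pt13_mem_bln13 (t : Fin 11) : σ.pt13 h12 hne hq t ∈ σ.bln13 h12 hne hq := (σ.ept13 h12 hne hq t).2.1

/-- `P_t ≠ P₀`. -/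
theorem pt13_ne_fpt13 (t : Fin 11) : σ.pt13 h12 hne hq t ≠ σ.fpt13 h12 hne hq := (σ.ept13 h12 hne hq t).2.2.1

/-- `P_t ≠ Q`. -/
theorem pt13_ne_bpt13 (t : Fin 11) : σ.pt13 h12 hne hq t ≠ σ.bpt13 h12 hne hq := (σ.ept13 h12 hne hq t).2.2.2

/-- `t ↦ P_t` is injective. -/
theorem pt13_injective : Function.Injective (σ.pt13 h12 hne hq) := fun _ _ h =>
  (σ.ept13 h12 hne hq).injective (Subtype.ext h)

/-- every point of `N` other than `P₀, Q` is a `P_t` -/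
theorem exists_pt13_eq {p : P} (h1 : p ∈ σ.bln13 h12 hne hq) (h2 : p ≠ σ.fpt13 h12 hne hq) (h3 : p ≠ σ.bpt13 h12 hne hq) :
    ∃ t, σ.pt13 h12 hne hq t = p := by
  obtain ⟨t, ht⟩ := (σ.ept13 h12 hne hq).surjective ⟨p, h1, h2, h3⟩
  exact ⟨t, by rw [pt13, ht]⟩

/-- `P_t ∉ l₀`. -/
theorem pt13_not_mem_fln13 (t : Fin 11) : σ.pt13 h12 hne hq t ∉ σ.fln13 h12 hne hq := fun h =>
  σ.pt13_ne_bpt13 h12 hne hq t (σ.eq_bpt13_of_mem_bln13_of_mem_fln13 h12 hne hq (σ.pt13_mem_bln13 h12 hne hq t) h)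

/-- `σ^k P_t ∉ l₀`. -/
theorem pow_pt13_not_mem_fln13 (k : ℕ) (t : Fin 11) : (σ.onPoints ^ k) (σ.pt13 h12 hne hq t) ∉ σ.fln13 h12 hne hq :=
  σ.pow_not_mem_fln13 h12 hne hq k (σ.pt13_not_mem_fln13 h12 hne hq t)

/-- `σ^k P_t ≠ P₀`. -/
theorem pow_pt13_ne_fpt13 (k : ℕ) (t : Fin 11) : (σ.onPoints ^ k) (σ.pt13 h12 hne hq t) ≠ σ.fpt13 h12 hne hq := by
  intro h
  rw [← σ.pow_fpt13 h12 hne hq k] at h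
  exact σ.pt13_ne_fpt13 h12 hne hq t ((σ.onPoints ^ k).injective h)

/-- `Q ∈ L_s`. -/
theorem bpt13_mem_ln13 (s : Fin 11) : σ.bpt13 h12 hne hq ∈ σ.ln13 h12 hne hq s := (σ.eln13 h12 hne hq s).2.1

/-- `L_s ≠ l₀`. -/
theorem ln13_ne_fln13 (s : Fin 11) : σ.ln13 h12 hne hq s ≠ σ.fln13 h12 hne hq := (σ.eln13 h12 hne hq s).2.2.1

/-- `L_s ≠ N`. -/
theorem ln13_ne_bln13 (s : Fin 11) : σ.ln13 h12 hne hq s ≠ σ.bln13 h12 hne hq := (σ.eln13 h12 hne hq s).2.2.2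

/-- `s ↦ L_s` is injective. -/
theorem ln13_injective : Function.Injective (σ.ln13 h12 hne hq) := fun _ _ h =>
  (σ.eln13 h12 hne hq).injective (Subtype.ext h)

/-- `L_s ∩ l₀ = {Q}`. -/
theorem eq_bpt13_of_mem_ln13_of_mem_fln13 (s : Fin 11) {p : P} (h1 : p ∈ σ.ln13 h12 hne hq s) (h2 : p ∈ σ.fln13 h12 hne hq) :
    p = σ.bpt13 h12 hne hq :=
  (Nondegenerate.eq_or_eq h1 (σ.bpt13_mem_ln13 h12 hne hq s) h2 (σ.bpt13_mem_fln13 h12 hne hq)).resolve_right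
    (σ.ln13_ne_fln13 h12 hne hq s)

/-- `L_s ∩ N = {Q}`. -/
theorem eq_bpt13_of_mem_ln13_of_mem_bln13 (s : Fin 11) {p : P} (h1 : p ∈ σ.ln13 h12 hne hq s) (h2 : p ∈ σ.bln13 h12 hne hq) :
    p = σ.bpt13 h12 hne hq :=
  (Nondegenerate.eq_or_eq h1 (σ.bpt13_mem_ln13 h12 hne hq s) h2 (σ.bpt13_mem_bln13 h12 hne hq)).resolve_right
    (σ.ln13_ne_bln13 h12 hne hq s)

/-- `L_s ∩ L_{s'} = {Q}` for `s ≠ s'`. -/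
theorem eq_bpt13_of_mem_ln13_of_mem_ln13 {s s' : Fin 11} (hss' : s ≠ s') {p : P} (h1 : p ∈ σ.ln13 h12 hne hq s)
    (h2 : p ∈ σ.ln13 h12 hne hq s') : p = σ.bpt13 h12 hne hq :=
  (Nondegenerate.eq_or_eq h1 (σ.bpt13_mem_ln13 h12 hne hq s) h2 (σ.bpt13_mem_ln13 h12 hne hq s')).resolve_right
    fun h => hss' (σ.ln13_injective h12 hne hq h)

/-- `P₀ ∉ L_s`. -/
theorem fpt13_not_mem_ln13 (s : Fin 11) : σ.fpt13 h12 hne hq ∉ σ.ln13 h12 hne hq s := fun h =>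
  σ.bpt13_ne_fpt13 h12 hne hq (σ.eq_bpt13_of_mem_ln13_of_mem_bln13 h12 hne hq s h (σ.fpt13_mem_bln13 h12 hne hq)).symm

/-- `P_t ∉ L_s`. -/
theorem pt13_not_mem_ln13 (s t : Fin 11) : σ.pt13 h12 hne hq t ∉ σ.ln13 h12 hne hq s := fun h =>
  σ.pt13_ne_bpt13 h12 hne hq t (σ.eq_bpt13_of_mem_ln13_of_mem_bln13 h12 hne hq s h (σ.pt13_mem_bln13 h12 hne hq t))

end Thirteen

end Collineation

end Summit.Ventures.DiscreteObjects.PP12
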